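import Mathlib.Algebra.Homology.HomologicalComplex
import Mathlib.Algebra.Homology.ShortComplex.ModuleCat
import Mathlib.LinearAlgebra.Quotient.Basic
import Mathlib.LinearAlgebra.Matrix.ToLin
import Mathlib.Order.WithBot
import Mathlib.LinearAlgebra.Dimension.Finrank
import Literature.Topology.FourManifolds.KhResolutions
import Literature.Topology.FourManifolds.KhComplex
import Literature.Topology.FourManifolds.GaussDiagrams
import Literature.Topology.FourManifolds.Knots
import HarnessLib

-- provenance: harness21/H21/H21/Prelude/FourManL/LeeRasmussen.lean @ d4d340d (interim HEAD d8f2665); M5 mechanical rewrite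
/-!
# Lee homology and Rasmussen's `s`-invariant (trunk T-4MAN / FourManL, outline C14)

This prelude file of the H21 library (trunk `FourManL`; notion `khovanov_homology_rasmussen_s`,
layer 3 of the tower `KhResolutions → KhComplex → LeeRasmussen`) specialises the Khovanov
complex of a Gauss diagram over the universal Frobenius system `R[X]/(X² - hX - t)`
(`KhComplex`) to Lee's deformation `(R, h, t) = (ℚ, 0, 1)` (`X² = 1`) and defines Rasmussen's
concordance invariant `s`:

* `leeD`, `leeComplex`, `leeHomology`, `LeeHomologyZero`, `leeCycles`: Lee's differential,
  cochain complex (for realisable diagrams), homology, its degree-zero carrier type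
  `ker d₀ ⧸ (im d₋₁ ⊓ ker d₀)` and the module of degree-zero cycles;
* the quantum filtration: `qMin x` (filtration degree of a chain: the least quantum degree of
  an enhanced state in its support), `classDegree α` (Rasmussen's `s(α)`: the best filtration
  degree of a representing cycle), `leeSMin`, `leeSMax` and
  `rasmussenInvariant G = s_max - 1`;
* the knot-level predicate `Knot.HasRasmussenInvariant K s`;
* the theorems of Lee (rank two in degree `0`, vanishing elsewhere, for knots) and Rasmussen
  (`s_max = s_min + 2`, `s` even, invariance, mirror), stated as named facts (`Prop`-valued
  definitions, D-0014), the (proved) value on the unknot, and existence and uniqueness of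
  `s(K)` for every knot `K` (proved from the named facts, taken as hypotheses).

## Sources

* E. S. Lee, *An endomorphism of the Khovanov invariant*, Adv. Math. 197 (2005) 554–586,
  §4, Thm. 4.2 (Lee homology of an `n`-component link has rank `2ⁿ`; for a knot it is `ℚ ⊕ ℚ`
  in homological degree `0`).
* J. Rasmussen, *Khovanov homology and the slice genus*, Invent. Math. 182 (2010) 419–447,
  §2 (Lee's theory, the filtration `s(x)`), §3 (Def. 3.1, Prop. 3.3: `s_max = s_min + 2`,
  Def. 3.4: `s(K) = s_max - 1 = s_min + 1`, Thm. 1: `s` is a knot invariant, even), §3.5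
  (mirror image: `s(K̄) = -s(K)`).
* M. Goussarov, M. Polyak, O. Viro, *Finite-type invariants of classical and virtual knots*,
  Topology 39 (2000), Thm. 1.B (realisable diagrams related by moves present isotopic knots).
* Mathlib: no Khovanov/Lee homology or Rasmussen invariant (searched `Khovanov`, `Rasmussen`,
  `Lee homology`); we use `LinearMap.ker`, `Submodule.Quotient.mk`, `Module.finrank`,
  `WithBot`/`WithTop` (`unbotD`, `untopD`), `HomologicalComplex.homology`,
  `CategoryTheory.Limits.IsZero`.

## Design choices

* As in `KhComplex` (review #1, option (b)): every *definition* is total on `GaussDiagram`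
  (which contains virtual diagrams) and relies on no named fact; statements that are about
  knots carry the realisability hypothesis `hG : ∃ K : Knot, K.HasGaussDiagram G`. Only
  `leeComplex` (a repackaging of `frobeniusComplex`) takes `hG` and the `d² = 0` fact `hd`.
* `leeCycles G` is *literally* the submodule `ker (khovanovD ℚ 0 1 0 (0 + 1))` whose quotient
  is the carrier `LeeHomologyZero G` of `frobeniusHomology ℚ 0 1 0`, so that
  `Submodule.Quotient.mk : leeCycles G → LeeHomologyZero G` typechecks with no casts.
* The filtration takes values in the complete lattice `WithBot (WithTop ℤ)`: `qMin 0 = ⊤`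
  (empty infimum), and suprema over empty sets are `⊥`. `rasmussenInvariant` extracts an
  integer with the documented junk values `⊥ ↦ ⊤ ↦ 0` before subtracting `1`; for realisable
  diagrams `leeSMax` is a genuine integer (`finrank_leeHomologyZero_eq_two`,
  `leeSMax_eq_leeSMin_add_two`). Sanity value: for the empty diagram (round unknot)
  `leeSMax = 1`, so `s(unknot) = 0` (`rasmussenInvariant_empty`).
* Knot level: `Knot.HasRasmussenInvariant K s` quantifies over isotopic representatives
  `K'` with a Gauss diagram (a given smooth knot need not have a regular projection), following
  the pattern of the accepted `IsAlexanderPolynomial`; well-definedness is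
  `Knot.existsUnique_hasRasmussenInvariant` (from the named facts
  `Knot.exists_hasGaussDiagram_of_isIsotopic`, `Knot.reidemeister`,
  `rasmussenInvariant_eq_of_equiv` and `[SphereEmbedding.IsotopyFacts 1 3]`, taken as
  hypotheses).
* Grading conventions are those of `KhComplex` (Bar-Natan): the unknot has Lee generators in
  `q = ±1`, Rasmussen (2010), §2–3.
-/

open Function Set CategoryTheory

noncomputable section

namespace Literature.Topology.FourManifolds

namespace GaussDiagram

variable (G : GaussDiagram)

/-! ## Lee's complex and homology -/

/-- **Lee's differential** from homological degree `i` to degree `i'` on the Gauss diagram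
`G`: the Khovanov differential over the Frobenius system `ℚ[X]/(X² - 1)`, i.e.
`khovanovD ℚ 0 1 i i'` (meaningful for `i' = i + 1`, zero otherwise). Lee (2005), §4;
Rasmussen (2010), §2.1. [cite: Lee2005] -/
abbrev leeD (i i' : ℤ) : (G.degStates i → ℚ) →ₗ[ℚ] (G.degStates i' → ℚ) :=
  G.khovanovD ℚ 0 1 i i'

/-- **Lee's cochain complex** of a realisable Gauss diagram, as a
`CochainComplex (ModuleCat ℚ) ℤ`: `frobeniusComplex ℚ 0 1 hd hG`.
Relies on: the named fact `khovanovD_comp_khovanovD` (`d² = 0`, true under `hG`), taken as the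
hypothesis `hd`, through `frobeniusComplex`.
Lee (2005), §4; Rasmussen (2010), §2.1. [cite: Lee2005] -/
def leeComplex (hd : G.khovanovD_comp_khovanovD ℚ) (hG : ∃ K : Knot, K.HasGaussDiagram G) :
    CochainComplex (ModuleCat ℚ) ℤ :=
  G.frobeniusComplex ℚ 0 1 hd hG

/-- **Lee homology** `Kh'^i(G)` of a Gauss diagram in homological degree `i`: the concrete
subquotient `ker dᵢ ⧸ (im dᵢ₋₁ ⊓ ker dᵢ)` of Lee's complex (`frobeniusHomology ℚ 0 1 i`).
Total; it is the honest homology for realisable diagrams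
(`nonempty_iso_leeHomology_homology`). Lee (2005), §4; Rasmussen (2010), §2.1. [cite: Lee2005] -/
def leeHomology (i : ℤ) : ModuleCat ℚ :=
  G.frobeniusHomology ℚ 0 1 i

/-- The carrier type of **Lee homology in degree zero**, `Kh'^0(G)`:
`↥(ker d₀) ⧸ (range d₋₁).comap (ker d₀).subtype` (the `ℚ`-module structure comes for free
from `ModuleCat`). For a knot diagram this is `ℚ ⊕ ℚ` (`finrank_leeHomologyZero_eq_two`).
Lee (2005), Thm. 4.2; Rasmussen (2010), §2.1. [cite: Lee2005] -/
abbrev LeeHomologyZero : Type := G.frobeniusHomology ℚ 0 1 0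

/-- The **degree-zero Lee cycles** `ker d₀ ≤ (degStates 0 → ℚ)`: literally the submodule
whose quotient is `LeeHomologyZero G`, so that
`Submodule.Quotient.mk : leeCycles G → LeeHomologyZero G` is the projection to homology.
Rasmussen (2010), §2.1, §3.1. [cite: Rasmussen2010] -/
abbrev leeCycles : Submodule ℚ (G.degStates 0 → ℚ) :=
  LinearMap.ker (G.khovanovD ℚ 0 1 0 (0 + 1))

/-! ## The quantum filtration and Rasmussen's `s` -/

variable {G} in
/-- The **filtration degree** of a degree-zero Lee chain `x`: the least quantum degree
`qDegree s` of an enhanced state `s` in the support of `x`, in the complete lattice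
`WithBot (WithTop ℤ)` (so `qMin 0 = ⊤`, the empty infimum). Lee's differential is
non-decreasing for this filtration. Rasmussen (2010), §2.1–2.2 (the `q`-grading `q(v)` of a
chain, `s(x)` for chains). [cite: Rasmussen2010] -/
def qMin (x : G.degStates 0 → ℚ) : WithBot (WithTop ℤ) :=
  ⨅ s ∈ {s | x s ≠ 0}, ((qDegree s.1 : WithTop ℤ) : WithBot (WithTop ℤ))

variable {G} in
/-- **Rasmussen's `s(α)`** for a degree-zero Lee homology class `α`: the filtration degree of
the class, i.e. the supremum of the filtration degrees `qMin z` of the cycles `z` representing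
`α` (`⊥` never occurs since every class has a representative; `s(0) = ⊤`).
Rasmussen (2010), §2.2, Def. 3.1. [cite: Rasmussen2010] -/
def classDegree (α : G.LeeHomologyZero) : WithBot (WithTop ℤ) :=
  ⨆ z ∈ {z : G.leeCycles | Submodule.Quotient.mk z = α}, qMin z.1

/-- **`s_min`** of a Gauss diagram: the least filtration degree of a nonzero degree-zero Lee
homology class. Rasmussen (2010), Def. 3.1. [cite: Rasmussen2010] -/
def leeSMin : WithBot (WithTop ℤ) :=
  ⨅ α ∈ {α : G.LeeHomologyZero | α ≠ 0}, classDegree α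

/-- **`s_max`** of a Gauss diagram: the greatest filtration degree of a nonzero degree-zero
Lee homology class. Rasmussen (2010), Def. 3.1. [cite: Rasmussen2010] -/
def leeSMax : WithBot (WithTop ℤ) :=
  ⨆ α ∈ {α : G.LeeHomologyZero | α ≠ 0}, classDegree α

/-- **Rasmussen's `s`-invariant** of a Gauss diagram: `s = s_max - 1` (`= s_min + 1` for knot
diagrams, `leeSMax_eq_leeSMin_add_two`). Total, with documented junk values: `leeSMax` is
turned into an integer by `⊥ ↦ ⊤` (`WithBot.unbotD`) and then `⊤ ↦ 0` (`WithTop.untopD`);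
for realisable diagrams `leeSMax ∈ ℤ` and no junk value is used. For the empty diagram
(round unknot) `s = 0` (`rasmussenInvariant_empty`). Rasmussen (2010), Def. 3.4. [cite: Rasmussen2010] -/
def rasmussenInvariant : ℤ :=
  ((G.leeSMax.unbotD ⊤).untopD 0) - 1

/-! ## Lee's and Rasmussen's theorems -/

/-- Lee homology agrees with the categorical homology of Lee's cochain complex for realisable
diagrams (special case of the named fact `nonempty_iso_frobeniusHomology_homology`, hypothesis
`hiso`). Lee (2005), §4. [cite: Lee2005] -/
theorem nonempty_iso_leeHomology_homology (hiso : G.nonempty_iso_frobeniusHomology_homology ℚ)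
    (hd : G.khovanovD_comp_khovanovD ℚ) (hG : ∃ K : Knot, K.HasGaussDiagram G) (i : ℤ) :
    Nonempty (G.leeHomology i ≅ (G.leeComplex hd hG).homology i) :=
  hiso 0 1 hd hG i

variable {G}

/-- **Lee's theorem, degree zero.** For a knot diagram, Lee homology in homological degree
`0` is two-dimensional over `ℚ` (generated by the classes of the two canonical cycles
`𝔰_o`, `𝔰_ō` attached to the two orientations). Lee (2005), Thm. 4.2;
Rasmussen (2010), §2.3–2.4. [cite: Lee2005] -/
def finrank_leeHomologyZero_eq_two : Prop :=
  ∀ {G : GaussDiagram} (_hG : ∃ K : Knot, K.HasGaussDiagram G),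
    Module.finrank ℚ G.LeeHomologyZero = 2

/-- **Lee's theorem, other degrees.** For a knot diagram, Lee homology vanishes in every
homological degree `i ≠ 0` (both canonical generators live in degree `0`, the degree of the
oriented resolution). Lee (2005), Thm. 4.2; Rasmussen (2010), Prop. 2.3. [cite: Lee2005] -/
def isZero_leeHomology_of_ne_zero : Prop :=
  ∀ {G : GaussDiagram} (_hG : ∃ K : Knot, K.HasGaussDiagram G) {i : ℤ} (_hi : i ≠ 0),
    Limits.IsZero (G.leeHomology i)

/-- **`s_max = s_min + 2`** for a knot diagram. Rasmussen (2010), Prop. 3.3. [cite: Rasmussen2010] -/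
def leeSMax_eq_leeSMin_add_two : Prop :=
  ∀ {G : GaussDiagram} (_hG : ∃ K : Knot, K.HasGaussDiagram G), G.leeSMax = G.leeSMin + 2

/-- Rasmussen's `s`-invariant of a knot diagram is **even** (all quantum degrees of a knot
diagram have the same parity, and `s_max`, `s_min` are odd). Rasmussen (2010), Prop. 3.3,
Thm. 1. [cite: Rasmussen2010] -/
def even_rasmussenInvariant : Prop :=
  ∀ {G : GaussDiagram} (_hG : ∃ K : Knot, K.HasGaussDiagram G), Even G.rasmussenInvariant

/-- **Invariance of `s`.** Two *realisable* Gauss diagrams related by Polyak's Reidemeister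
moves (accepted `GaussDiagram.Equiv`) have the same Rasmussen invariant: realisable diagrams
related by moves present isotopic knots (Goussarov–Polyak–Viro (2000), Thm. 1.B; accepted
`Knot.reidemeister`), Lee homology with its filtration is a knot invariant (Lee (2005), §4;
Rasmussen (2010), §2, Thm. 1). Both realisability hypotheses are needed since intermediate
diagrams of a chain of Polyak moves may be virtual. [cite: GoussarovPolyakViro2000] -/
def rasmussenInvariant_eq_of_equiv : Prop :=
  ∀ {G G' : GaussDiagram} (_hG : ∃ K : Knot, K.HasGaussDiagram G)
    (_hG' : ∃ K : Knot, K.HasGaussDiagram G') (_e : G.Equiv G'),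
    G.rasmussenInvariant = G'.rasmussenInvariant

/-- **Mirror image.** The Rasmussen invariant of the mirror diagram of a knot diagram is the
negative of the Rasmussen invariant: `s(K̄) = -s(K)` (Lee homology of the mirror is the dual
filtered vector space). Rasmussen (2010), §3.5 (behaviour under mirror image), Thm. 2. [cite: Rasmussen2010] -/
def rasmussenInvariant_mirror : Prop :=
  ∀ {G : GaussDiagram} (_hG : ∃ K : Knot, K.HasGaussDiagram G),
    G.mirror.rasmussenInvariant = -G.rasmussenInvariant

/-! ## The empty diagram (round unknot): `s = 0` -/

section Empty

/-- The empty diagram has no positive crossings. Bar-Natan (2002), §3.1. [cite: BarNatan2002] -/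
theorem nPlus_empty : GaussDiagram.empty.nPlus = 0 := by
  haveI : IsEmpty (Fin GaussDiagram.empty.n) := inferInstanceAs (IsEmpty (Fin 0))
  simp [nPlus]

/-- The empty diagram has no negative crossings. Bar-Natan (2002), §3.1. [cite: BarNatan2002] -/
theorem nMinus_empty : GaussDiagram.empty.nMinus = 0 := by
  haveI : IsEmpty (Fin GaussDiagram.empty.n) := inferInstanceAs (IsEmpty (Fin 0))
  simp [nMinus]

/-- Every state of the empty diagram has weight `0`. Bar-Natan (2002), §3.1. [cite: BarNatan2002] -/
theorem State.weight_empty (σ : GaussDiagram.empty.State) : σ.weight = 0 := by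
  haveI : IsEmpty (Fin GaussDiagram.empty.n) := inferInstanceAs (IsEmpty (Fin 0))
  simp [State.weight]

/-- Every enhanced state of the empty diagram has homological degree `0`.
Bar-Natan (2002), §3.2 (the unknot). [cite: BarNatan2002] -/
theorem homDegree_empty (s : GaussDiagram.empty.EnhancedState) : homDegree s = 0 := by
  simp [homDegree, State.weight_empty, nMinus_empty]

/-- Every state of the empty diagram has exactly one state circle (`circleCount_empty`).
Bar-Natan (2002), §3.1. [cite: BarNatan2002] -/
theorem card_stateCircle_empty (σ : GaussDiagram.empty.State) :
    Fintype.card (GaussDiagram.empty.StateCircle σ) = 1 := by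
  haveI : Unique GaussDiagram.empty.State := inferInstanceAs (Unique (Fin 0 → Bool))
  obtain rfl : σ = Fin.elim0 := Subsingleton.elim _ _
  exact circleCount_empty

/-- Every enhanced state of the empty diagram has quantum degree at most `1` (in fact `±1`:
one circle, labelled `1` or `X`). Bar-Natan (2002), §3.2. [cite: BarNatan2002] -/
theorem qDegree_empty_le (s : GaussDiagram.empty.EnhancedState) : qDegree s ≤ 1 := by
  have h1 := card_stateCircle_empty s.state
  simp only [qDegree, State.weight_empty, nPlus_empty, nMinus_empty, Nat.cast_zero, add_zero,
    mul_zero, sub_zero]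
  have hle : ((Finset.univ.filter fun c : GaussDiagram.empty.StateCircle s.state ↦
      ∃ a, GaussDiagram.empty.circleOf s.state a = c ∧ s.label a = false).card : ℤ) ≤ 1 := by
    have := h1 ▸ Finset.card_le_univ (Finset.univ.filter fun c :
      GaussDiagram.empty.StateCircle s.state ↦
      ∃ a, GaussDiagram.empty.circleOf s.state a = c ∧ s.label a = false)
    exact_mod_cast this
  linarith [Nat.cast_nonneg (α := ℤ) ((Finset.univ.filter fun c :
      GaussDiagram.empty.StateCircle s.state ↦
      ∃ a, GaussDiagram.empty.circleOf s.state a = c ∧ s.label a = true).card)]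

/-- The enhanced state of the empty diagram (round unknot) whose single circle is labelled
`1`: the top-degree Lee generator of the unknot. Bar-Natan (2002), §3.2;
Rasmussen (2010), §2.3. [cite: BarNatan2002] -/
def oneStateEmpty : GaussDiagram.empty.EnhancedState where
  state := Fin.elim0
  label := fun _ ↦ false
  label_eq := fun _ _ _ ↦ rfl

/-- The circle of the unknot labelled `1` has quantum degree `1`. Bar-Natan (2002), §3.2. [cite: BarNatan2002] -/
theorem qDegree_oneStateEmpty : qDegree oneStateEmpty = 1 := by
  have h1 := card_stateCircle_empty oneStateEmpty.state
  simp only [qDegree, State.weight_empty, nPlus_empty, nMinus_empty, Nat.cast_zero, add_zero,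
    mul_zero, sub_zero]
  have hA : (Finset.univ.filter fun c : GaussDiagram.empty.StateCircle oneStateEmpty.state ↦
      ∃ a, GaussDiagram.empty.circleOf oneStateEmpty.state a = c ∧
        oneStateEmpty.label a = false) = Finset.univ := by
    apply Finset.filter_true_of_mem
    intro c _
    induction c using SimpleGraph.ConnectedComponent.ind with
    | h v => exact ⟨v, rfl, rfl⟩
  have hB : (Finset.univ.filter fun c : GaussDiagram.empty.StateCircle oneStateEmpty.state ↦
      ∃ a, GaussDiagram.empty.circleOf oneStateEmpty.state a = c ∧
        oneStateEmpty.label a = true) = ∅ := by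
    apply Finset.filter_false_of_mem
    rintro c - ⟨a, -, ha⟩
    exact Bool.false_ne_true ha
  rw [hA, hB, Finset.card_univ, h1]
  simp

/-- The empty diagram has no enhanced states of nonzero homological degree, so all Lee (and
Khovanov) differentials of the unknot vanish. Bar-Natan (2002), §3.2. [cite: BarNatan2002] -/
theorem isEmpty_degStates_empty {i : ℤ} (hi : i ≠ 0) :
    IsEmpty (GaussDiagram.empty.degStates i) :=
  ⟨fun s ↦ hi (s.2.symm.trans (homDegree_empty s.1))⟩

/-- For the empty diagram the projection from degree-zero Lee cycles to Lee homology is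
injective (the incoming differential `d₋₁` has zero domain). Rasmussen (2010), §2.3. [cite: Rasmussen2010] -/
theorem mk_leeCycles_empty_eq_zero_iff (z : GaussDiagram.empty.leeCycles) :
    (Submodule.Quotient.mk z : GaussDiagram.empty.LeeHomologyZero) = 0 ↔ z = 0 := by
  rw [Submodule.Quotient.mk_eq_zero, Submodule.mem_comap, LinearMap.mem_range]
  haveI : IsEmpty (GaussDiagram.empty.degStates (0 - 1)) := isEmpty_degStates_empty (by decide)
  constructor
  · rintro ⟨y, hy⟩
    rw [Subsingleton.elim y 0, map_zero] at hy
    exact Subtype.ext hy.symm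
  · rintro rfl
    exact ⟨0, by rw [map_zero]; rfl⟩

/-- **`s_max` of the unknot is `1`**: every nonzero degree-zero cycle of the empty diagram is
supported on states of quantum degree `≤ 1`, and the cycle `[circle labelled 1]` has
filtration degree exactly `1` and nonzero class. Rasmussen (2010), §3 (unknot). [cite: Rasmussen2010] -/
theorem leeSMax_empty : GaussDiagram.empty.leeSMax = 1 := by
  apply le_antisymm
  · refine iSup₂_le fun α hα ↦ iSup₂_le fun z hz ↦ ?_
    have hz : Submodule.Quotient.mk z = α := hz
    have hz0 : z ≠ 0 := by
      rintro rfl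
      exact hα (hz ▸ (mk_leeCycles_empty_eq_zero_iff 0).2 rfl)
    obtain ⟨s, hs⟩ : ∃ s, z.1 s ≠ 0 := by
      by_contra! h
      exact hz0 (Subtype.ext (funext h))
    exact (iInf₂_le s hs).trans (by exact_mod_cast qDegree_empty_le s.1)
  · let s0 : GaussDiagram.empty.degStates 0 := ⟨oneStateEmpty, homDegree_empty _⟩
    have hker : Pi.single s0 (1 : ℚ) ∈ GaussDiagram.empty.leeCycles := by
      haveI : IsEmpty (GaussDiagram.empty.degStates (0 + 1)) :=
        isEmpty_degStates_empty (by decide)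
      exact Subsingleton.elim _ _
    let z0 : GaussDiagram.empty.leeCycles := ⟨_, hker⟩
    have hz0 : z0 ≠ 0 := fun h ↦ by
      have := congrArg (fun z : GaussDiagram.empty.leeCycles ↦ z.1 s0) h
      simp [z0] at this
    refine le_iSup₂_of_le (Submodule.Quotient.mk z0)
      (fun h ↦ hz0 ((mk_leeCycles_empty_eq_zero_iff z0).1 h)) (le_iSup₂_of_le z0 rfl ?_)
    refine le_iInf₂ fun s hs ↦ ?_
    have : s = s0 := by
      by_contra hne
      exact hs (Pi.single_eq_of_ne hne _)
    subst this
    exact_mod_cast qDegree_oneStateEmpty.ge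

/-- **The Rasmussen invariant of the unknot is `0`**: for the empty diagram (round unknot)
the two enhanced states have quantum degrees `±1`, all differentials vanish, `s_max = 1`
(`leeSMax_empty`), so `s = s_max - 1 = 0`. Rasmussen (2010), §3 (the unknot has `s = 0`). [cite: Rasmussen2010] -/
theorem rasmussenInvariant_empty : GaussDiagram.empty.rasmussenInvariant = 0 := by
  rw [rasmussenInvariant, leeSMax_empty]
  rfl

end Empty

end GaussDiagram

/-! ## The knot-level predicate -/

namespace Knot

/-- The knot `K` **has Rasmussen invariant** `s`: some knot `K'` isotopic to `K` has a Gauss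
diagram `D` (regular projection) whose Rasmussen invariant is `s`. The existential over
isotopic representatives is needed because a given smooth knot need not have a regular
projection; every knot has a unique such `s` (`existsUnique_hasRasmussenInvariant`).
Rasmussen (2010), Def. 3.4, Thm. 1. [cite: Rasmussen2010] -/
def HasRasmussenInvariant (K : Knot) (s : ℤ) : Prop :=
  ∃ (K' : Knot) (D : GaussDiagram), K.IsIsotopic K' ∧ K'.HasGaussDiagram D ∧
    D.rasmussenInvariant = s

/-- The Rasmussen invariant predicate is invariant under isotopy of the knot (immediate from
transitivity of `IsIsotopic`, the named fact `[SphereEmbedding.IsotopyFacts 1 3]`).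
Rasmussen (2010), Thm. 1. [cite: Rasmussen2010] -/
theorem HasRasmussenInvariant.of_isIsotopic [SphereEmbedding.IsotopyFacts 1 3] {K K' : Knot}
    {s : ℤ} (h : K'.HasRasmussenInvariant s) (hK : K.IsIsotopic K') :
    K.HasRasmussenInvariant s := by
  obtain ⟨K'', D, hK', hD, hs⟩ := h
  exact ⟨K'', D, SphereEmbedding.IsotopyFacts.trans hK hK', hD, hs⟩

/-- **Rasmussen's `s(K)` is a well-defined knot invariant**: every knot has exactly one
Rasmussen invariant. Existence: every knot is isotopic to one with a Gauss diagram (named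
fact `Knot.exists_hasGaussDiagram_of_isIsotopic`, hypothesis `hex`); uniqueness: Gauss
diagrams of isotopic knots are related by Polyak moves (named fact `Knot.reidemeister`,
hypothesis `hR`) and `s` is invariant under those between realisable diagrams (named fact
`GaussDiagram.rasmussenInvariant_eq_of_equiv`, hypothesis `hinv`); symmetry and transitivity
of isotopy are `[SphereEmbedding.IsotopyFacts 1 3]`.
Rasmussen (2010), Thm. 1. [cite: Rasmussen2010] -/
theorem existsUnique_hasRasmussenInvariant [SphereEmbedding.IsotopyFacts 1 3]
    (hex : Knot.exists_hasGaussDiagram_of_isIsotopic) (hR : Knot.reidemeister)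
    (hinv : GaussDiagram.rasmussenInvariant_eq_of_equiv) (K : Knot) :
    ∃! s, K.HasRasmussenInvariant s := by
  obtain ⟨K', D, hK', hD⟩ := hex K
  refine ⟨D.rasmussenInvariant, ⟨K', D, hK', hD, rfl⟩, ?_⟩
  rintro s ⟨K'', D', hK'', hD', rfl⟩
  exact hinv ⟨K'', hD'⟩ ⟨K', hD⟩
    ((hR hD' hD).1
      (SphereEmbedding.IsotopyFacts.trans (SphereEmbedding.IsotopyFacts.symm hK'') hK'))

end Knot

end Literature.Topology.FourManifolds
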